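import Summits.PneNP.PneNP.Theorems.KarlinRubinMonotoneBlindLocalOr

/-!
# Route KarlinRubin, crux `MonotoneBlind` (stmt-PneNP-18027): local-OR blindness (theorem)

**Theorem** (`karlinRubin_localOr_planted_tendsto_zero`). Let `0 < δ < 1/2`, `ε > 0`, `c : ℕ`. For each `n` let
`f_n = ⋁_{i < m n} g n i` be an OR of `m n ≤ n^c` (eventually) ARBITRARY Boolean tests on the edge slots of `Kₙ`, the
test `g n i` depending only on the slots inside a vertex set `V n i` with `|V n i| ≤ n^{1/2+δ-ε}` (eventually, all
`i`). If `Pr_{G(n,1/2)}[f_n = 1] → 0` then `Pr_{G(n,1/2,⌈n^{1/2-δ}⌉)}[f_n = 1] → 0`. Hence no such family has error sum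
`→ 0` (`karlinRubin_blind_localOr`), and no circuit family computing such ORs strongly detects
(`karlinRubin_not_detects_of_computes_localOr`). This covers every "polynomially many seeds × local verification"
detector whose verification reads `≤ n^{1/2+δ-ε}` vertices (guess-and-verify with local tests, narrow DNFs, brute
force over poly many candidate sets), monotone or not. Engine: `localOr_planted_le_null_add` (witness lemma for
slot-supported tests + hypergeometric tail, `KarlinRubinMonotoneBlindLocalOr.lean`); here only the asymptotics
(`(⌊n^{1/2+δ-ε}⌋ · d)^q · n ≤ n^q` eventually for `q = ⌈2/ε⌉ + 1`).

All `--supports stmt-PneNP-18027`; no definitions.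
-/

set_option linter.dupNamespace false -- `Summit.PneNP.PneNP.…`: summit = sub-problem (D-0017)

namespace Summit.PneNP.PneNP.Theorems

open Filter Topology Finset
open scoped ENNReal
open Literature.Computability.Complexity
open Literature.Probability.RandomGraphs.PlantedClique

/-- **The support hypothesis holds eventually**: with `vmax = ⌊n^{1/2+δ-ε}⌋`, `d = min(⌈n^{1/2-δ}⌉, n)` and
`q = ⌈2/ε⌉ + 1`, eventually `(vmax · d)^q · n ≤ n^q` (`vmax d ≤ 2 n^{1-ε}`, `qε ≥ 2`, `2^q ≤ n`). [folklore] -/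
theorem eventually_localOr_H {δ ε : ℝ} (hδ' : δ < 1 / 2) (hε : 0 < ε) :
    ∀ᶠ n : ℕ in atTop, (⌊(n : ℝ) ^ (1 / 2 + δ - ε)⌋₊ * min ⌈(n : ℝ) ^ (1 / 2 - δ)⌉₊ n) ^ (⌈2 / ε⌉₊ + 1) * n ≤
      n ^ (⌈2 / ε⌉₊ + 1) := by
  set q := ⌈2 / ε⌉₊ + 1 with hq
  have hqε : (2 : ℝ) ≤ q * ε := by
    have h1 : (2 / ε : ℝ) ≤ ⌈2 / ε⌉₊ := Nat.le_ceil _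
    have h2 : (q : ℝ) = ⌈2 / ε⌉₊ + 1 := by rw [hq]; push_cast; ring
    rw [h2, add_mul, one_mul]
    have : 2 / ε * ε = 2 := div_mul_cancel₀ 2 hε.ne'
    nlinarith [mul_le_mul_of_nonneg_right h1 hε.le]
  filter_upwards [eventually_ge_atTop (2 ^ q), eventually_ge_atTop 1] with n h2q hn1
  have hnpos : 0 < n := hn1
  have hnR : (1 : ℝ) ≤ n := by exact_mod_cast hn1
  have hnR0 : (0 : ℝ) < n := by exact_mod_cast hnpos
  have hv : (⌊(n : ℝ) ^ (1 / 2 + δ - ε)⌋₊ : ℝ) ≤ (n : ℝ) ^ (1 / 2 + δ - ε) := Nat.floor_le (by positivity)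
  have hd : min ((⌈(n : ℝ) ^ (1 / 2 - δ)⌉₊ : ℕ) : ℝ) (n : ℝ) ≤ 2 * (n : ℝ) ^ (1 / 2 - δ) := by
    refine (min_le_left _ _).trans ?_
    -- `⌈n^{1/2-δ}⌉ < n^{1/2-δ} + 1 ≤ 2 n^{1/2-δ}` (`n ≥ 1`)
    have h1 : (1 : ℝ) ≤ (n : ℝ) ^ (1 / 2 - δ) := Real.one_le_rpow hnR (by linarith)
    have h2 : (⌈(n : ℝ) ^ (1 / 2 - δ)⌉₊ : ℝ) < (n : ℝ) ^ (1 / 2 - δ) + 1 :=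
      Nat.ceil_lt_add_one (by positivity)
    linarith
  have hprod : min ((⌈(n : ℝ) ^ (1 / 2 - δ)⌉₊ : ℕ) : ℝ) (n : ℝ) * (⌊(n : ℝ) ^ (1 / 2 + δ - ε)⌋₊ : ℝ) ≤
      2 * (n : ℝ) ^ (1 - ε) := by
    have hsplit : (n : ℝ) ^ (1 / 2 + δ - ε) * (n : ℝ) ^ (1 / 2 - δ) = (n : ℝ) ^ (1 - ε) := by
      rw [← Real.rpow_add hnR0]; ring_nf
    have hm0 : (0 : ℝ) ≤ min ((⌈(n : ℝ) ^ (1 / 2 - δ)⌉₊ : ℕ) : ℝ) (n : ℝ) := by positivity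
    calc min ((⌈(n : ℝ) ^ (1 / 2 - δ)⌉₊ : ℕ) : ℝ) (n : ℝ) * (⌊(n : ℝ) ^ (1 / 2 + δ - ε)⌋₊ : ℝ)
        ≤ (2 * (n : ℝ) ^ (1 / 2 - δ)) * (n : ℝ) ^ (1 / 2 + δ - ε) := by gcongr
      _ = 2 * (n : ℝ) ^ (1 - ε) := by rw [← hsplit]; ring
  have hexp : ((n : ℝ) ^ (1 - ε)) ^ q * n ≤ (n : ℝ) ^ ((q - 1 : ℕ) : ℝ) := by
    rw [← Real.rpow_natCast, ← Real.rpow_mul hnR0.le, ← Real.rpow_add_one hnR0.ne']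
    refine Real.rpow_le_rpow_of_exponent_le hnR ?_
    have hq1 : 1 ≤ q := Nat.le_add_left 1 _
    rw [Nat.cast_sub hq1]
    push_cast
    nlinarith
  have hreal : (((⌊(n : ℝ) ^ (1 / 2 + δ - ε)⌋₊ * min ⌈(n : ℝ) ^ (1 / 2 - δ)⌉₊ n) ^ q * n : ℕ) : ℝ) ≤
      ((n ^ q : ℕ) : ℝ) := by
    have h2qR : ((2 : ℝ) ^ q) ≤ n := by exact_mod_cast h2q
    have hq1 : 1 ≤ q := Nat.le_add_left 1 _
    push_cast
    have hm0 : (0 : ℝ) ≤ (⌊(n : ℝ) ^ (1 / 2 + δ - ε)⌋₊ : ℝ) * min ((⌈(n : ℝ) ^ (1 / 2 - δ)⌉₊ : ℕ) : ℝ) (n : ℝ) := by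
      positivity
    calc ((⌊(n : ℝ) ^ (1 / 2 + δ - ε)⌋₊ : ℝ) * min ((⌈(n : ℝ) ^ (1 / 2 - δ)⌉₊ : ℕ) : ℝ) (n : ℝ)) ^ q * n
        ≤ (2 * (n : ℝ) ^ (1 - ε)) ^ q * n := by
          refine mul_le_mul_of_nonneg_right (pow_le_pow_left₀ hm0 ?_ q) (Nat.cast_nonneg _)
          rw [mul_comm]
          exact hprod
      _ = 2 ^ q * (((n : ℝ) ^ (1 - ε)) ^ q * n) := by rw [mul_pow]; ring
      _ ≤ n * (n : ℝ) ^ ((q - 1 : ℕ) : ℝ) := by gcongr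
      _ = (n : ℝ) ^ q := by
          rw [Real.rpow_natCast, ← pow_succ', Nat.sub_add_cancel hq1]
  exact_mod_cast hreal

/-- **Local-OR blindness.** For `0 < δ < 1/2`, `ε > 0` and `c : ℕ`: ORs of `≤ n^c` arbitrary tests, each depending
only on the slots inside a vertex set of size `≤ n^{1/2+δ-ε}`, that are quiet under `G(n,1/2)` have planted
acceptance `→ 0` at clique size `⌈n^{1/2-δ}⌉`. [folklore] -/
theorem karlinRubin_localOr_planted_tendsto_zero {δ ε : ℝ} (hδ : 0 < δ) (hδ' : δ < 1 / 2) (hε : 0 < ε) (c : ℕ)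
    (m : ℕ → ℕ) (g : (n : ℕ) → Fin (m n) → EdgeVec n → Bool) (V : (n : ℕ) → Fin (m n) → Finset (Fin n))
    (hm : ∀ᶠ n : ℕ in atTop, m n ≤ n ^ c)
    (hsupp : ∀ n (i : Fin (m n)) (x y : EdgeVec n), (∀ e : (⊤ : SimpleGraph (Fin n)).edgeSet,
      (∀ v ∈ (e : Sym2 (Fin n)), v ∈ V n i) → x e = y e) → g n i x = g n i y)
    (hV : ∀ᶠ n : ℕ in atTop, ∀ i, (#(V n i) : ℝ) ≤ (n : ℝ) ^ (1 / 2 + δ - ε))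
    (hquiet : Tendsto (fun n : ℕ =>
      (erdosRenyiHalf n).toOuterMeasure {x | ∃ i, g n i x = true}) atTop (𝓝 0)) :
    Tendsto (fun n : ℕ => (plantedCliqueDist n ⌈(n : ℝ) ^ (1 / 2 - δ)⌉₊).toOuterMeasure
      {x | ∃ i, g n i x = true}) atTop (𝓝 0) := by
  have _ := hδ
  set q := ⌈2 / ε⌉₊ + 1 with hq
  set t := (q * (c + 2) - 1).choose 2 with ht
  have hinv : Tendsto (fun n : ℕ => (((n ^ 2 : ℕ) : ℝ≥0∞))⁻¹) atTop (𝓝 0) := by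
    refine tendsto_of_tendsto_of_tendsto_of_le_of_le' tendsto_const_nhds ENNReal.tendsto_inv_nat_nhds_zero
      (Eventually.of_forall fun _ => bot_le) ?_
    filter_upwards [eventually_ge_atTop 1] with n hn
    apply ENNReal.inv_le_inv.2
    exact_mod_cast (Nat.le_self_pow two_ne_zero n)
  have hbound : Tendsto (fun n : ℕ => (2 : ℝ≥0∞) ^ t *
      (erdosRenyiHalf n).toOuterMeasure {x | ∃ i, g n i x = true} + (((n ^ 2 : ℕ) : ℝ≥0∞))⁻¹) atTop (𝓝 0) := by
    have h1 := ENNReal.Tendsto.const_mul hquiet (Or.inr (ENNReal.pow_ne_top ENNReal.ofNat_ne_top) :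
      (0 : ℝ≥0∞) ≠ 0 ∨ (2 : ℝ≥0∞) ^ t ≠ ⊤)
    simpa using h1.add hinv
  refine tendsto_of_tendsto_of_tendsto_of_le_of_le' tendsto_const_nhds hbound
    (Eventually.of_forall fun _ => bot_le) ?_
  filter_upwards [hm, hV, eventually_localOr_H hδ' hε, eventually_ge_atTop 1] with n hmn hVn hH hn1
  refine localOr_planted_le_null_add hn1 _ (g n) (V n) (hsupp n) (fun i => ?_) hH hmn
  exact Nat.le_floor (hVn i)

/-- **No quiet-and-loud local OR.** Under the hypotheses of `karlinRubin_localOr_planted_tendsto_zero`, the error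
sum `Pr_{G(n,1/2)}[f_n = 1] + Pr_{planted}[f_n = 0]` does not tend to `0`. [folklore] -/
theorem karlinRubin_blind_localOr {δ ε : ℝ} (hδ : 0 < δ) (hδ' : δ < 1 / 2) (hε : 0 < ε) (c : ℕ)
    (m : ℕ → ℕ) (g : (n : ℕ) → Fin (m n) → EdgeVec n → Bool) (V : (n : ℕ) → Fin (m n) → Finset (Fin n))
    (hm : ∀ᶠ n : ℕ in atTop, m n ≤ n ^ c)
    (hsupp : ∀ n (i : Fin (m n)) (x y : EdgeVec n), (∀ e : (⊤ : SimpleGraph (Fin n)).edgeSet,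
      (∀ v ∈ (e : Sym2 (Fin n)), v ∈ V n i) → x e = y e) → g n i x = g n i y)
    (hV : ∀ᶠ n : ℕ in atTop, ∀ i, (#(V n i) : ℝ) ≤ (n : ℝ) ^ (1 / 2 + δ - ε)) :
    ¬ Tendsto (fun n : ℕ =>
        (erdosRenyiHalf n).toOuterMeasure {x | ∃ i, g n i x = true} +
          (plantedCliqueDist n ⌈(n : ℝ) ^ (1 / 2 - δ)⌉₊).toOuterMeasure {x | ¬ ∃ i, g n i x = true})
        atTop (𝓝 0) := by
  intro hT
  have hquiet : Tendsto (fun n : ℕ =>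
      (erdosRenyiHalf n).toOuterMeasure {x | ∃ i, g n i x = true}) atTop (𝓝 0) :=
    tendsto_of_tendsto_of_tendsto_of_le_of_le' tendsto_const_nhds hT (Eventually.of_forall fun _ => bot_le)
      (Eventually.of_forall fun _ => le_self_add)
  have hP := karlinRubin_localOr_planted_tendsto_zero hδ hδ' hε c m g V hm hsupp hV hquiet
  have hhalf : (0 : ℝ≥0∞) < 1 / 2 := by simp
  obtain ⟨n, hn1, hn2⟩ := ((hT.eventually (gt_mem_nhds hhalf)).and (hP.eventually (gt_mem_nhds hhalf))).exists
  have hcompl : (plantedCliqueDist n ⌈(n : ℝ) ^ (1 / 2 - δ)⌉₊).toOuterMeasure {x | ∃ i, g n i x = true} +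
      (plantedCliqueDist n ⌈(n : ℝ) ^ (1 / 2 - δ)⌉₊).toOuterMeasure {x | ¬ ∃ i, g n i x = true} = 1 := by
    have h := (plantedCliqueDist n ⌈(n : ℝ) ^ (1 / 2 - δ)⌉₊).toOuterMeasure_add_compl {x | ∃ i, g n i x = true}
    have hc : {x : EdgeVec n | ¬ ∃ i, g n i x = true} = {x : EdgeVec n | ∃ i, g n i x = true}ᶜ := by
      ext x; simp
    rw [hc]
    exact h
  have hR : (plantedCliqueDist n ⌈(n : ℝ) ^ (1 / 2 - δ)⌉₊).toOuterMeasure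
      {x | ¬ ∃ i, g n i x = true} < 1 / 2 := lt_of_le_of_lt le_add_self hn1
  have hlt : (1 : ℝ≥0∞) < 1 / 2 + 1 / 2 := by
    calc (1 : ℝ≥0∞) = _ := hcompl.symm
      _ < 1 / 2 + 1 / 2 := ENNReal.add_lt_add hn2 hR
  rw [ENNReal.add_halves] at hlt
  exact lt_irrefl _ hlt

/-- **No circuit family computing a quiet polynomial OR of local tests strongly detects** (circuits over any basis,
any size; "local" = depends only on the slots inside `≤ n^{1/2+δ-ε}` vertices). [folklore] -/
theorem karlinRubin_not_detects_of_computes_localOr {δ ε : ℝ} (hδ : 0 < δ) (hδ' : δ < 1 / 2) (hε : 0 < ε) (c : ℕ)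
    (C : (n : ℕ) → Circuit ((⊤ : SimpleGraph (Fin n)).edgeSet))
    (m : ℕ → ℕ) (g : (n : ℕ) → Fin (m n) → EdgeVec n → Bool) (V : (n : ℕ) → Fin (m n) → Finset (Fin n))
    (hC : ∀ᶠ n : ℕ in atTop, ∀ x, (C n).eval x = true ↔ ∃ i, g n i x = true)
    (hm : ∀ᶠ n : ℕ in atTop, m n ≤ n ^ c)
    (hsupp : ∀ n (i : Fin (m n)) (x y : EdgeVec n), (∀ e : (⊤ : SimpleGraph (Fin n)).edgeSet,
      (∀ v ∈ (e : Sym2 (Fin n)), v ∈ V n i) → x e = y e) → g n i x = g n i y)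
    (hV : ∀ᶠ n : ℕ in atTop, ∀ i, (#(V n i) : ℝ) ≤ (n : ℝ) ^ (1 / 2 + δ - ε)) :
    ¬ Tendsto (fun n : ℕ =>
        (erdosRenyiHalf n).toOuterMeasure {x | (C n).eval x = true} +
          (plantedCliqueDist n ⌈(n : ℝ) ^ (1 / 2 - δ)⌉₊).toOuterMeasure {x | (C n).eval x = false})
        atTop (𝓝 0) := by
  intro hT
  refine karlinRubin_blind_localOr hδ hδ' hε c m g V hm hsupp hV (hT.congr' ?_)
  filter_upwards [hC] with n hn
  have h1 : {x : EdgeVec n | (C n).eval x = true} = {x | ∃ i, g n i x = true} := by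
    ext x; exact hn x
  have h2 : {x : EdgeVec n | (C n).eval x = false} = {x | ¬ ∃ i, g n i x = true} := by
    ext x
    simp only [Set.mem_setOf_eq, ← hn x, Bool.not_eq_true]
  rw [h1, h2]

/-- **stub_localOrBlind** (registered side result of stmt-PneNP-18027; NOT a stub of the picked line's composition):
local-OR blindness in `∀`-form — `karlinRubin_blind_localOr` with all parameters explicit. [folklore] -/
theorem stub_localOrBlind : ∀ δ ε : ℝ, 0 < δ → δ < 1 / 2 → 0 < ε → ∀ c : ℕ, ∀ m : ℕ → ℕ, ∀ g : (n : ℕ) → Fin (m n) → EdgeVec n → Bool, ∀ V : (n : ℕ) → Fin (m n) → Finset (Fin n), (∀ᶠ n : ℕ in atTop, m n ≤ n ^ c) → (∀ (n : ℕ) (i : Fin (m n)) (x y : EdgeVec n), (∀ e : (⊤ : SimpleGraph (Fin n)).edgeSet, (∀ v ∈ (e : Sym2 (Fin n)), v ∈ V n i) → x e = y e) → g n i x = g n i y) → (∀ᶠ n : ℕ in atTop, ∀ i : Fin (m n), ((V n i).card : ℝ) ≤ (n : ℝ) ^ (1 / 2 + δ - ε)) → ¬ Tendsto (fun n : ℕ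 => (erdosRenyiHalf n).toOuterMeasure {x | ∃ i, g n i x = true} + (plantedCliqueDist n ⌈(n : ℝ) ^ (1 / 2 - δ)⌉₊).toOuterMeasure {x | ¬ ∃ i, g n i x = true}) atTop (𝓝 0) :=
  fun _ _ hδ hδ' hε c m g V hm hsupp hV => karlinRubin_blind_localOr hδ hδ' hε c m g V hm hsupp hV

end Summit.PneNP.PneNP.Theorems
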